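import Summits.PneNP.PneNP.Theorems.ChebyshevTracialDesignTightEvenEigenvalues
import HarnessLib

/-!
# Cell pnp-psdrank, route `ChebyshevTracialDesign`: the second eigenvalue of the tight Gram kernel is below `λ₀/n`

Harmonic backbone, brick 5g (the numerical heart of the σ₂ brick). From the closed form (★★) (brick 5e) at `κ' = 0` and `κ' = 1`:
for `t = 2c+1`, `c ≥ 1`, `n` even, `2t ≤ n`, and `κ` the Gram class function of the tight incidence,
  `kernelEigen n t 2 κ · (t·(n−t)·n) = kernelEigen n t 0 κ · ((t−1)·(n−t−1))`           (`kernelEigen_two_mul_eq`)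
— i.e. `λ₂/λ₀ = (t−1)(n−t−1)/(t(n−t)·n) < 1/n` EXACTLY (= 8/125, 2/35 at (10,5), (12,5): the brute-force ratios of MEMO-7 §2) — and
hence `kernelEigen n t 2 κ ≤ kernelEigen n t 0 κ / n` (`kernelEigen_two_le`). Inputs: (★★) with the pmCount recursion
`(s+1)·pm(s) = pm(s+2)` (eng p442980) and a telescoping identity for the ladder products. With `λ₀ = d_R·d_C`
(lit's `kernelEigen_zero_eq_rowSum_mul_colSum`) this is the statement "the tight relation between t-cuts and perfect matchings of
`K_n` has normalised second singular value `< 1/√n`" [cite: Rothvoss2017, §2 (PDF p. 6)] [cite: GodsilMeagher2015, §15.2];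
the remaining step to «tight-free ⇒ μν < (1+ε)/n» is the tail `Σ_{κ'≥2} λ_{2κ'} ≤ ε·λ₂` for brick 5f's `Λ`.
WHAT THIS IS NOT: the tail bound; nothing on psd rank. Supports crux stmt-PneNP-19878.
-/

set_option linter.dupNamespace false -- `Summit.PneNP.PneNP.…`: summit = sub-problem (D-0017)

noncomputable section

namespace Summit.PneNP.PneNP.Theorems.ChebyshevTracialDesignTightSecondEigenvalue

open Finset Literature.Combinatorics.AssociationSchemes Literature.Combinatorics.AssociationSchemes.JohnsonHarmonics
open Literature.Combinatorics.AssociationSchemes.JohnsonSpectrum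
open Literature.Barriers.PneNP
open Summit.PneNP.PneNP.Theorems.ChebyshevTracialDesignTightEvenEigenvalues
open Summit.PneNP.PneNP.Theorems.ChebyshevTracialDesignClosedPairCount

variable {n : ℕ}

/-! ### §1 The two ladder products -/

/-- Telescoping between the ladder products of the layers `0` and `2`:
`(Π_{i<m} λ_0(i)) · (n−m)(n−m−1)(n−m−2)(n−m−3) = (Π_{i<m} λ_2(i)) · n(n−1)(n−2)(n−3)`. -/
theorem ladder_prod_telescope (m : ℕ) :
    (∏ i ∈ range m, ladder n 0 i) * (((n : ℝ) - m) * ((n : ℝ) - m - 1) * ((n : ℝ) - m - 2) * ((n : ℝ) - m - 3)) =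
      (∏ i ∈ range m, ladder n 2 i) * ((n : ℝ) * ((n : ℝ) - 1) * ((n : ℝ) - 2) * ((n : ℝ) - 3)) := by
  induction m with
  | zero => simp
  | succ m ih =>
    rw [prod_range_succ, prod_range_succ]
    have e0 : ladder n 0 m = ((m : ℝ) + 1) * ((n : ℝ) - m) := by unfold ladder; push_cast; ring
    have e2 : ladder n 2 m = ((m : ℝ) + 1) * ((n : ℝ) - 4 - m) := by unfold ladder; push_cast; ring
    rw [e0, e2]
    have : (∏ i ∈ range m, ladder n 0 i) * (((m : ℝ) + 1) * ((n : ℝ) - m)) *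
        (((n : ℝ) - (m + 1 : ℕ)) * ((n : ℝ) - (m + 1 : ℕ) - 1) * ((n : ℝ) - (m + 1 : ℕ) - 2) * ((n : ℝ) - (m + 1 : ℕ) - 3)) =
        ((∏ i ∈ range m, ladder n 0 i) * (((n : ℝ) - m) * ((n : ℝ) - m - 1) * ((n : ℝ) - m - 2) * ((n : ℝ) - m - 3))) *
          (((m : ℝ) + 1) * ((n : ℝ) - m - 4)) := by push_cast; ring
    rw [this, ih]; ring

/-- `P₀ · (n−t)(n−t−1) = P₂ · (t−1) t · n(n−1)(n−2)(n−3)` for the ladder products `P₀ = Π_{i<t} λ_0(i)`,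
`P₂ = Π_{i<t−2} λ_2(i)`, `t = m + 2`. -/
theorem ladder_prod_zero_two (m : ℕ) :
    (∏ i ∈ range (m + 2), ladder n 0 i) * (((n : ℝ) - (m + 2 : ℕ)) * ((n : ℝ) - (m + 2 : ℕ) - 1)) =
      (∏ i ∈ range m, ladder n 2 i) * ((((m : ℝ) + 1) * ((m : ℝ) + 2)) *
        ((n : ℝ) * ((n : ℝ) - 1) * ((n : ℝ) - 2) * ((n : ℝ) - 3))) := by
  rw [prod_range_succ, prod_range_succ]
  have e0 : ladder n 0 m = ((m : ℝ) + 1) * ((n : ℝ) - m) := by unfold ladder; push_cast; ring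
  have e1 : ladder n 0 (m + 1) = ((m : ℝ) + 2) * ((n : ℝ) - m - 1) := by unfold ladder; push_cast; ring
  rw [e0, e1]
  have tel := ladder_prod_telescope (n := n) m
  push_cast
  linear_combination (((m : ℝ) + 1) * ((m : ℝ) + 2)) * tel

/-! ### §2 `λ₂ · t(n−t)n = λ₀ · (t−1)(n−t−1)` -/

/-- **The second ladder eigenvalue of the tight Gram kernel, exactly:** for `n` even, `t = 2c+1` with `c ≥ 1` and `2t ≤ n`,
`kernelEigen n t 2 κ · (t(n−t)n) = kernelEigen n t 0 κ · ((t−1)(n−t−1))`. -/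
theorem kernelEigen_two_mul_eq {c : ℕ} (hn : Even n) (hc : 1 ≤ c) (ht : 2 * (2 * c + 1) ≤ n) (κ : ℕ → ℝ)
    (hA : ∀ U ∈ univ.powersetCard (2 * c + 1), ∀ U' ∈ univ.powersetCard (2 * c + 1),
      ∑ M : PMatch n, (if (U.filter fun x => M.2.partner x ∉ U).card = 1 then (1 : ℝ) else 0) *
        (if (U'.filter fun x => M.2.partner x ∉ U').card = 1 then (1 : ℝ) else 0) = κ (U ∩ U').card) :
    kernelEigen n (2 * c + 1) 2 κ * (((2 * c + 1 : ℕ) : ℝ) * ((n : ℝ) - (2 * c + 1 : ℕ)) * n) =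
      kernelEigen n (2 * c + 1) 0 κ * ((((2 * c + 1 : ℕ) : ℝ) - 1) * ((n : ℝ) - (2 * c + 1 : ℕ) - 1)) := by
  obtain ⟨N, hN⟩ := hn
  have hN2 : n = 2 * N := by omega
  -- the closed forms at κ' = 1 and κ' = 0 (product form)
  have h1 := kernelEigen_tight_even_mul_ladderProd ht hc κ hA
  have h0 := kernelEigen_tight_even_mul_ladderProd ht (Nat.zero_le c) κ hA
  -- evaluate the `d`-sums
  have hsum1 : ∑ d ∈ range (2 * 1 + 1),
      (if Even d then ((2 * 1).choose d : ℝ) * pmCount (2 * 1 - d) * pmCount d ^ 2 * pmCount (n - 2 * 1 - d) else 0) =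
      (pmCount (n - 2) : ℝ) + pmCount (n - 4) := by
    simp only [sum_range_succ, sum_range_zero, show (2 * 1 : ℕ) = 2 from rfl]
    norm_num [pmCount_zero, pmCount_two]
    rw [show n - 2 - 2 = n - 4 by omega]
  have hsum0 : ∑ d ∈ range (2 * 0 + 1),
      (if Even d then ((2 * 0).choose d : ℝ) * pmCount (2 * 0 - d) * pmCount d ^ 2 * pmCount (n - 2 * 0 - d) else 0) =
      (pmCount n : ℝ) := by
    simp [pmCount_zero]
  rw [hsum1] at h1
  rw [hsum0] at h0
  -- pmCount recursion: pm(n−2) = (n−3)·pm(n−4), pm(n) = (n−1)(n−3)·pm(n−4)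
  have hpm2 : (pmCount (n - 2) : ℝ) = ((n : ℝ) - 3) * pmCount (n - 4) := by
    have h := succ_mul_pmCount (n - 4)
    rw [show n - 4 + 2 = n - 2 by omega] at h
    have h' : (((n - 4 + 1 : ℕ) : ℝ)) * (pmCount (n - 4) : ℝ) = pmCount (n - 2) := by exact_mod_cast h
    have e : (((n - 4 + 1 : ℕ) : ℝ)) = (n : ℝ) - 3 := by
      rw [show n - 4 + 1 = n - 3 by omega]; push_cast [show 3 ≤ n by omega]; ring
    rw [← h', e]
  have hpm0 : (pmCount n : ℝ) = ((n : ℝ) - 1) * (((n : ℝ) - 3) * pmCount (n - 4)) := by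
    rw [← hpm2]
    have h := succ_mul_pmCount (n - 2)
    rw [show n - 2 + 2 = n by omega] at h
    have h' : (((n - 2 + 1 : ℕ) : ℝ)) * (pmCount (n - 2) : ℝ) = pmCount n := by exact_mod_cast h
    have e : (((n - 2 + 1 : ℕ) : ℝ)) = (n : ℝ) - 1 := by
      rw [show n - 2 + 1 = n - 1 by omega]; push_cast [show 1 ≤ n by omega]; ring
    rw [← h', e]
  -- binomial relation: c(N−c)·C(N,c) = N(N−1)·C(N−2,c−1)
  have hcN : c + 1 ≤ N := by omega
  have hbin : ((c : ℝ) * ((N : ℝ) - c)) * (N.choose c : ℝ) = ((N : ℝ) * ((N : ℝ) - 1)) * ((N - 2).choose (c - 1) : ℝ) := by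
    -- (i) C(N,c)·c = N·C(N−1,c−1)   (ii) C(N−1,c−1)·(N−c) = (N−1)·C(N−2,c−1)
    have i1 : N.choose c * c = N * (N - 1).choose (c - 1) := by
      have h := Nat.choose_mul (n := N) (k := c) (s := 1) hc
      rw [Nat.choose_one_right, Nat.choose_one_right] at h
      exact h
    have i2 : (N - 2).choose (c - 1) * (N - 1) = (N - 1).choose (c - 1) * (N - c) := by
      have h := Nat.choose_mul_succ_eq (N - 2) (c - 1)
      rw [show N - 2 + 1 = N - 1 by omega, show N - 1 - (c - 1) = N - c by omega] at h
      exact h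
    have i1' : (N.choose c : ℝ) * c = N * ((N - 1).choose (c - 1) : ℝ) := by exact_mod_cast i1
    have i2' : ((N - 2).choose (c - 1) : ℝ) * ((N : ℝ) - 1) = ((N - 1).choose (c - 1) : ℝ) * ((N : ℝ) - c) := by
      have e1 : (((N - 1 : ℕ) : ℝ)) = (N : ℝ) - 1 := by push_cast [show 1 ≤ N by omega]; ring
      have e2 : (((N - c : ℕ) : ℝ)) = (N : ℝ) - c := by push_cast [show c ≤ N by omega]; ring
      rw [← e1, ← e2]; exact_mod_cast i2
    calc ((c : ℝ) * ((N : ℝ) - c)) * (N.choose c : ℝ) = ((N.choose c : ℝ) * c) * ((N : ℝ) - c) := by ring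
      _ = N * (((N - 1).choose (c - 1) : ℝ) * ((N : ℝ) - c)) := by rw [i1']; ring
      _ = N * (((N - 2).choose (c - 1) : ℝ) * ((N : ℝ) - 1)) := by rw [i2']
      _ = _ := by ring
  -- ladder products: P₀ · (n−t)(n−t−1) = P₂ · 2c(2c+1) · n(n−1)(n−2)(n−3)
  have hP := ladder_prod_zero_two (n := n) (2 * c - 1)
  rw [show 2 * c - 1 + 2 = 2 * c + 1 by omega] at hP
  -- the two eigenvalue identities without the powers of two
  have hprod1 : 0 < ∏ i ∈ range (2 * c + 1 - 2 * 1), ladder n (2 * 1) i := ladderProd_range_pos (by omega) ht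
  have hprod0 : 0 < ∏ i ∈ range (2 * c + 1), ladder n 0 i := by
    have := ladderProd_range_pos (n := n) (t := 2 * c + 1) (j := 0) (by omega) ht
    simpa using this
  have h1' : kernelEigen n (2 * c + 1) 2 κ * ∏ i ∈ range (2 * c - 1), ladder n 2 i =
      (((2 * c - 1).factorial : ℝ) * (((n : ℝ) - (2 * c : ℕ) - (2 : ℕ)) *
        (((N - 2).choose (c - 1) : ℕ) : ℝ))) ^ 2 * ((pmCount (n - 2) : ℝ) + pmCount (n - 4)) := by
    have e : 2 * c + 1 - 2 * 1 = 2 * c - 1 := by omega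
    have e' : n / 2 - 2 * 1 = N - 2 := by omega
    rw [e, e'] at h1
    have h1x : kernelEigen n (2 * c + 1) 2 κ * ((∏ i ∈ range (2 * c - 1), ladder n 2 i) * (2 : ℝ) ^ 2) =
        (((2 * c - 1).factorial : ℝ) * (((n : ℝ) - (2 * c : ℕ) - (2 : ℕ)) *
          (((N - 2).choose (c - 1) : ℕ) : ℝ))) ^ 2 * ((2 : ℝ) ^ 2 * ((pmCount (n - 2) : ℝ) + pmCount (n - 4))) := by
      simpa using h1
    have h2 : (2 : ℝ) ^ 2 ≠ 0 := by positivity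
    apply mul_right_cancel₀ h2
    rw [mul_assoc, h1x]; ring
  have h0' : kernelEigen n (2 * c + 1) 0 κ * ∏ i ∈ range (2 * c + 1), ladder n 0 i =
      (((2 * c + 1).factorial : ℝ) * (((n : ℝ) - (2 * c : ℕ)) * ((N.choose c : ℕ) : ℝ))) ^ 2 *
        (pmCount n : ℝ) := by
    have e' : n / 2 = N := by omega
    rw [e'] at h0
    simpa using h0
  -- numeric atoms
  have hfac : (((2 * c + 1).factorial : ℕ) : ℝ) = (2 * (c : ℝ) + 1) * (2 * (c : ℝ)) * (((2 * c - 1).factorial : ℕ) : ℝ) := by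
    rw [show 2 * c + 1 = (2 * c - 1) + 1 + 1 by omega, Nat.factorial_succ, Nat.factorial_succ]
    have e : (((2 * c - 1 : ℕ) : ℝ)) = 2 * (c : ℝ) - 1 := by push_cast [show 1 ≤ 2 * c by omega]; ring
    push_cast
    rw [e]; ring
  have hn' : (n : ℝ) = 2 * (N : ℝ) := by exact_mod_cast hN2
  have hbin2 : ((c : ℝ) * ((N : ℝ) - c)) ^ 2 * (N.choose c : ℝ) ^ 2 =
      ((N : ℝ) * ((N : ℝ) - 1)) ^ 2 * ((N - 2).choose (c - 1) : ℝ) ^ 2 := by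
    rw [← mul_pow, ← mul_pow, hbin]
  have hc1 : (1 : ℝ) ≤ c := by exact_mod_cast hc
  have hq : ((n : ℝ) - (2 * c + 1 : ℕ)) * ((n : ℝ) - (2 * c + 1 : ℕ) - 1) ≠ 0 := by
    have : ((4 * c + 2 : ℕ) : ℝ) ≤ n := by exact_mod_cast (by omega : 4 * c + 2 ≤ n)
    push_cast at this ⊢
    have e1 : (0 : ℝ) < (n : ℝ) - (2 * c + 1) := by linarith
    have e2 : (0 : ℝ) < (n : ℝ) - (2 * c + 1) - 1 := by linarith
    positivity
  have hNc : ((c : ℝ) * ((N : ℝ) - c)) ^ 2 ≠ 0 := by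
    have e2 : (c : ℝ) + 1 ≤ N := by exact_mod_cast hcN
    have e3 : (0 : ℝ) < (N : ℝ) - c := by linarith
    positivity
  have hP1ne : (∏ i ∈ range (2 * c - 1), ladder n 2 i) ≠ 0 := by
    have := hprod1; rw [show 2 * c + 1 - 2 * 1 = 2 * c - 1 by omega] at this; exact this.ne'
  apply mul_right_cancel₀ hP1ne
  apply mul_right_cancel₀ hprod0.ne'
  apply mul_right_cancel₀ hq
  apply mul_right_cancel₀ hNc
  -- regroup so that `h1'`, `h0'`, `hP`, `hbin2` apply
  have eL : kernelEigen n (2 * c + 1) 2 κ * (((2 * c + 1 : ℕ) : ℝ) * ((n : ℝ) - (2 * c + 1 : ℕ)) * n) *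
      (∏ i ∈ range (2 * c - 1), ladder n 2 i) * (∏ i ∈ range (2 * c + 1), ladder n 0 i) *
      (((n : ℝ) - (2 * c + 1 : ℕ)) * ((n : ℝ) - (2 * c + 1 : ℕ) - 1)) * ((c : ℝ) * ((N : ℝ) - c)) ^ 2 =
      (kernelEigen n (2 * c + 1) 2 κ * ∏ i ∈ range (2 * c - 1), ladder n 2 i) *
        ((((2 * c + 1 : ℕ) : ℝ) * ((n : ℝ) - (2 * c + 1 : ℕ)) * n) * ((c : ℝ) * ((N : ℝ) - c)) ^ 2) *
        ((∏ i ∈ range (2 * c + 1), ladder n 0 i) * (((n : ℝ) - (2 * c + 1 : ℕ)) * ((n : ℝ) - (2 * c + 1 : ℕ) - 1))) := by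
    ring
  have eR : kernelEigen n (2 * c + 1) 0 κ * ((((2 * c + 1 : ℕ) : ℝ) - 1) * ((n : ℝ) - (2 * c + 1 : ℕ) - 1)) *
      (∏ i ∈ range (2 * c - 1), ladder n 2 i) * (∏ i ∈ range (2 * c + 1), ladder n 0 i) *
      (((n : ℝ) - (2 * c + 1 : ℕ)) * ((n : ℝ) - (2 * c + 1 : ℕ) - 1)) * ((c : ℝ) * ((N : ℝ) - c)) ^ 2 =
      (kernelEigen n (2 * c + 1) 0 κ * ∏ i ∈ range (2 * c + 1), ladder n 0 i) *
        (((((2 * c + 1 : ℕ) : ℝ) - 1) * ((n : ℝ) - (2 * c + 1 : ℕ) - 1)) *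
          (∏ i ∈ range (2 * c - 1), ladder n 2 i) *
          (((n : ℝ) - (2 * c + 1 : ℕ)) * ((n : ℝ) - (2 * c + 1 : ℕ) - 1))) * (((c : ℝ) * ((N : ℝ) - c)) ^ 2 * 1) := by
    ring
  rw [eL, eR, h1', h0', hP, hpm2, hpm0, hfac]
  -- a polynomial identity in the atoms P₂, C(N−2,c−1), C(N,c), pm(n−4), (2c−1)!, c, N — modulo `hbin2`
  have ec : (((2 * c - 1 : ℕ) : ℝ)) = 2 * (c : ℝ) - 1 := by push_cast [show 1 ≤ 2 * c by omega]; ring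
  rw [hn']
  push_cast
  rw [ec]
  linear_combination
    (-((((2 * (c : ℝ) + 1) * (2 * (c : ℝ))) * (((2 * c - 1).factorial : ℕ) : ℝ)) ^ 2 * (2 * (N : ℝ) - 2 * (c : ℝ)) ^ 2 *
      ((2 * (N : ℝ) - 1) * ((2 * (N : ℝ) - 3) * (pmCount (n - 4) : ℝ))) *
      ((2 * (c : ℝ)) * (2 * (N : ℝ) - 2 * (c : ℝ) - 2)) * (∏ i ∈ range (2 * c - 1), ladder n 2 i) *
      ((2 * (N : ℝ) - 2 * (c : ℝ) - 1) * (2 * (N : ℝ) - 2 * (c : ℝ) - 2)))) * hbin2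

/-- **`λ₂ ≤ λ₀/n`.** Under the same hypotheses, `kernelEigen n t 2 κ ≤ kernelEigen n t 0 κ / n`. -/
theorem kernelEigen_two_le {c : ℕ} (hn : Even n) (hc : 1 ≤ c) (ht : 2 * (2 * c + 1) ≤ n) (κ : ℕ → ℝ)
    (hA : ∀ U ∈ univ.powersetCard (2 * c + 1), ∀ U' ∈ univ.powersetCard (2 * c + 1),
      ∑ M : PMatch n, (if (U.filter fun x => M.2.partner x ∉ U).card = 1 then (1 : ℝ) else 0) *
        (if (U'.filter fun x => M.2.partner x ∉ U').card = 1 then (1 : ℝ) else 0) = κ (U ∩ U').card) :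
    kernelEigen n (2 * c + 1) 2 κ ≤ kernelEigen n (2 * c + 1) 0 κ / n := by
  have h := kernelEigen_two_mul_eq hn hc ht κ hA
  -- λ₀ ≥ 0 from the closed form (a square times pm(n) over a positive product)
  have h0 := kernelEigen_tight_even_mul_ladderProd ht (Nat.zero_le c) κ hA
  have hprod0 : 0 < ∏ i ∈ range (2 * c + 1 - 2 * 0), ladder n (2 * 0) i := ladderProd_range_pos (by omega) ht
  have hl0 : 0 ≤ kernelEigen n (2 * c + 1) 0 κ := by
    have hrhs : 0 ≤ kernelEigen n (2 * c + 1) (2 * 0) κ *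
        ((∏ i ∈ range (2 * c + 1 - 2 * 0), ladder n (2 * 0) i) * (2 : ℝ) ^ (2 * 0)) := by
      rw [h0]
      refine mul_nonneg (sq_nonneg _) (mul_nonneg (by positivity) (sum_nonneg fun d _ => ?_))
      split_ifs
      · positivity
      · exact le_refl _
    have hpos : 0 < (∏ i ∈ range (2 * c + 1 - 2 * 0), ladder n (2 * 0) i) * (2 : ℝ) ^ (2 * 0) := by positivity
    have := (mul_nonneg_iff_of_pos_right hpos).1 hrhs
    simpa using this
  have hnpos : (0 : ℝ) < n := by
    have : (6 : ℝ) ≤ n := by exact_mod_cast (by omega : 6 ≤ n)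
    linarith
  have ht' : (0 : ℝ) < ((2 * c + 1 : ℕ) : ℝ) * ((n : ℝ) - (2 * c + 1 : ℕ)) := by
    have : ((4 * c + 2 : ℕ) : ℝ) ≤ n := by exact_mod_cast (by omega : 4 * c + 2 ≤ n)
    push_cast at this ⊢
    have : (0 : ℝ) < (n : ℝ) - (2 * c + 1) := by linarith
    positivity
  rw [le_div_iff₀ hnpos]
  -- λ₂ · n · [t(n−t)] = λ₀ (t−1)(n−t−1) ≤ λ₀ · t(n−t)
  have key : kernelEigen n (2 * c + 1) 2 κ * n * (((2 * c + 1 : ℕ) : ℝ) * ((n : ℝ) - (2 * c + 1 : ℕ))) ≤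
      kernelEigen n (2 * c + 1) 0 κ * (((2 * c + 1 : ℕ) : ℝ) * ((n : ℝ) - (2 * c + 1 : ℕ))) := by
    have e : kernelEigen n (2 * c + 1) 2 κ * n * (((2 * c + 1 : ℕ) : ℝ) * ((n : ℝ) - (2 * c + 1 : ℕ))) =
        kernelEigen n (2 * c + 1) 0 κ * ((((2 * c + 1 : ℕ) : ℝ) - 1) * ((n : ℝ) - (2 * c + 1 : ℕ) - 1)) := by
      rw [← h]; ring
    rw [e]
    refine mul_le_mul_of_nonneg_left ?_ hl0
    have : ((4 * c + 2 : ℕ) : ℝ) ≤ n := by exact_mod_cast (by omega : 4 * c + 2 ≤ n)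
    push_cast at this ⊢
    nlinarith
  exact le_of_mul_le_mul_right key ht'

end Summit.PneNP.PneNP.Theorems.ChebyshevTracialDesignTightSecondEigenvalue
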